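import Summits.PneNP.PneNP.Theorems.KarlinRubinMonotoneBlindDnfWitness

/-!
# Route KarlinRubin, crux `MonotoneBlind` (stmt-PneNP-18027): clique-restriction switching — the canonical run

Seat write-up `MonotoneBlind_AC0_announce.md` on the item. This is the first file of the CLIQUE-RESTRICTION SWITCHING
LEMMA (Håstad's switching lemma with Razborov–Beame encoding, for the restrictions "fix every slot outside `E(V)` at
random, leave the slots inside the vertex set `V` free", with VERTEX accounting).

A monotone CNF on the slots of `Kₙ` is a list `l` of clauses (finite slot sets); a slot `e` is *inside* `V` if both
endpoints lie in `V`. Given the outside assignment `x` and an inside assignment `z`, the **canonical run**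
`swRun V x z l K` processes the clauses in order with a set `K` of already *queried* inside slots: a clause with a black
outside slot (under `x`) or a black queried inside slot (under `z`) is skipped; otherwise all its inside slots are
queried, and the run stops with value `0` if they are all white, else continues; at the end the value is `1`.

* `swRun_fst_eq_true_iff` — the value is the CNF at the hybrid input (`x` outside, `z` inside), whatever `K`;
* `subset_swRun_snd`, `swRun_snd_subset` — the queried set only grows, by inside slots of clauses;
* `swRun_congr_inside` — determinacy: inside assignments agreeing on the final queried set have the same run;
* `swRun_congr_outside` — the run depends on `x` only through the slots not inside `V`;
* `swRun_dnf` — **DNF extraction**: the restricted CNF is the OR, over accepted `z`, of the AND of the black queried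
  slots of `z`; with `swRun_exists_dnf`: if every run queries `≤ r` slots, the restricted CNF equals an `r`-DNF whose
  terms are inside `V` (at most `#{T ⊆ slots : #T ≤ r}` of them, `switch_card_filter_powerset_card_le`).

All `--supports stmt-PneNP-18027`. The only definition is the run itself (a structural recursion on the clause list).
-/

set_option linter.dupNamespace false -- `Summit.PneNP.PneNP.…`: summit = sub-problem (D-0017)

namespace Summit.PneNP.PneNP.Theorems

open Finset
open Literature.Computability.Complexity
open Literature.Probability.RandomGraphs.PlantedClique

variable {n : ℕ}

/-! ### The canonical run -/

open Classical in
/-- **Canonical run** of the monotone CNF with clause list `l` under the clique restriction `(V, x)` on the inside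
assignment `z`, from the queried set `K`: returns the value and the final queried set (Beame's canonical decision tree
of `F|ρ`, read along the input `z`). [cite: Beame1994, §3] -/
noncomputable def swRun (V : Finset (Fin n)) (x z : EdgeVec n) :
    List (Finset (⊤ : SimpleGraph (Fin n)).edgeSet) → Finset (⊤ : SimpleGraph (Fin n)).edgeSet →
      Bool × Finset (⊤ : SimpleGraph (Fin n)).edgeSet
  | [], K => (true, K)
  | S :: l, K =>
    if ∃ e ∈ S, (¬ ∀ v ∈ (e : Sym2 (Fin n)), v ∈ V) ∧ x e = true then swRun V x z l K
    else if ∃ e ∈ S, (∀ v ∈ (e : Sym2 (Fin n)), v ∈ V) ∧ e ∈ K ∧ z e = true then swRun V x z l K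
    else if ∀ e ∈ S, (∀ v ∈ (e : Sym2 (Fin n)), v ∈ V) → z e = false then
      (false, K ∪ S.filter fun e => ∀ v ∈ (e : Sym2 (Fin n)), v ∈ V)
    else swRun V x z l (K ∪ S.filter fun e => ∀ v ∈ (e : Sym2 (Fin n)), v ∈ V)

/-- The run on the empty clause list. [folklore] -/
@[simp] theorem swRun_nil (V : Finset (Fin n)) (x z : EdgeVec n) (K : Finset (⊤ : SimpleGraph (Fin n)).edgeSet) :
    swRun V x z [] K = (true, K) := rfl

open Classical in
/-- One step of the run (definitional unfolding). [folklore] -/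
theorem swRun_cons (V : Finset (Fin n)) (x z : EdgeVec n) (S : Finset (⊤ : SimpleGraph (Fin n)).edgeSet)
    (l : List (Finset (⊤ : SimpleGraph (Fin n)).edgeSet)) (K : Finset (⊤ : SimpleGraph (Fin n)).edgeSet) :
    swRun V x z (S :: l) K =
      if ∃ e ∈ S, (¬ ∀ v ∈ (e : Sym2 (Fin n)), v ∈ V) ∧ x e = true then swRun V x z l K
      else if ∃ e ∈ S, (∀ v ∈ (e : Sym2 (Fin n)), v ∈ V) ∧ e ∈ K ∧ z e = true then swRun V x z l K
      else if ∀ e ∈ S, (∀ v ∈ (e : Sym2 (Fin n)), v ∈ V) → z e = false then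
        (false, K ∪ S.filter fun e => ∀ v ∈ (e : Sym2 (Fin n)), v ∈ V)
      else swRun V x z l (K ∪ S.filter fun e => ∀ v ∈ (e : Sym2 (Fin n)), v ∈ V) := rfl

/-! ### Value of the run -/

open Classical in
/-- **The run computes the restricted CNF**: its value is `1` iff every clause has a black slot at the hybrid input
(`x` on the slots not inside `V`, `z` on the slots inside `V`) — independently of the initial queried set. [cite: Beame1994, §3] -/
theorem swRun_fst_eq_true_iff (V : Finset (Fin n)) (x z : EdgeVec n)
    (l : List (Finset (⊤ : SimpleGraph (Fin n)).edgeSet)) (K : Finset (⊤ : SimpleGraph (Fin n)).edgeSet) :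
    (swRun V x z l K).1 = true ↔
      ∀ S ∈ l, ∃ e ∈ S, ((∀ v ∈ (e : Sym2 (Fin n)), v ∈ V) ∧ z e = true) ∨
        ((¬ ∀ v ∈ (e : Sym2 (Fin n)), v ∈ V) ∧ x e = true) := by
  induction l generalizing K with
  | nil => simp
  | cons S l ih =>
    rw [swRun_cons]
    split_ifs with h1 h2 h3
    · rw [ih]
      refine ⟨fun h T hT => ?_, fun h T hT => h T (List.mem_cons_of_mem _ hT)⟩
      rcases List.mem_cons.1 hT with rfl | hT
      · obtain ⟨e, he, he1, he2⟩ := h1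
        exact ⟨e, he, Or.inr ⟨he1, he2⟩⟩
      · exact h T hT
    · rw [ih]
      refine ⟨fun h T hT => ?_, fun h T hT => h T (List.mem_cons_of_mem _ hT)⟩
      rcases List.mem_cons.1 hT with rfl | hT
      · obtain ⟨e, he, he1, -, he2⟩ := h2
        exact ⟨e, he, Or.inl ⟨he1, he2⟩⟩
      · exact h T hT
    · refine iff_of_false (by simp) fun h => ?_
      obtain ⟨e, he, h'⟩ := h S List.mem_cons_self
      rcases h' with ⟨he1, he2⟩ | ⟨he1, he2⟩
      · rw [h3 e he he1] at he2
        exact Bool.false_ne_true he2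
      · exact h1 ⟨e, he, he1, he2⟩
    · have hex : ∃ e ∈ S, (∀ v ∈ (e : Sym2 (Fin n)), v ∈ V) ∧ z e = true := by
        by_contra hc
        refine h3 fun e he he1 => ?_
        cases hze : z e
        · rfl
        · exact absurd ⟨e, he, he1, hze⟩ hc
      rw [ih]
      refine ⟨fun h T hT => ?_, fun h T hT => h T (List.mem_cons_of_mem _ hT)⟩
      rcases List.mem_cons.1 hT with rfl | hT
      · obtain ⟨e, he, he1, he2⟩ := hex
        exact ⟨e, he, Or.inl ⟨he1, he2⟩⟩
      · exact h T hT

/-! ### The queried set -/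

open Classical in
/-- The queried set only grows along the run. [folklore] -/
theorem subset_swRun_snd (V : Finset (Fin n)) (x z : EdgeVec n)
    (l : List (Finset (⊤ : SimpleGraph (Fin n)).edgeSet)) (K : Finset (⊤ : SimpleGraph (Fin n)).edgeSet) :
    K ⊆ (swRun V x z l K).2 := by
  induction l generalizing K with
  | nil => simp
  | cons S l ih =>
    rw [swRun_cons]
    split_ifs
    · exact ih K
    · exact ih K
    · exact subset_union_left
    · exact subset_union_left.trans (ih _)

open Classical in
/-- The queried set consists of initial slots and inside slots of clauses. [folklore] -/
theorem swRun_snd_subset (V : Finset (Fin n)) (x z : EdgeVec n)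
    (l : List (Finset (⊤ : SimpleGraph (Fin n)).edgeSet)) (K : Finset (⊤ : SimpleGraph (Fin n)).edgeSet) :
    (swRun V x z l K).2 ⊆ K ∪ univ.filter fun e : (⊤ : SimpleGraph (Fin n)).edgeSet =>
      (∀ v ∈ (e : Sym2 (Fin n)), v ∈ V) ∧ ∃ S ∈ l, e ∈ S := by
  induction l generalizing K with
  | nil => simp
  | cons S l ih =>
    have hstep : ∀ K' : Finset (⊤ : SimpleGraph (Fin n)).edgeSet,
        K' ⊆ K ∪ S.filter (fun e => ∀ v ∈ (e : Sym2 (Fin n)), v ∈ V) →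
        (K' ∪ univ.filter fun e : (⊤ : SimpleGraph (Fin n)).edgeSet =>
          (∀ v ∈ (e : Sym2 (Fin n)), v ∈ V) ∧ ∃ T ∈ l, e ∈ T) ⊆
        K ∪ univ.filter fun e : (⊤ : SimpleGraph (Fin n)).edgeSet =>
          (∀ v ∈ (e : Sym2 (Fin n)), v ∈ V) ∧ ∃ T ∈ S :: l, e ∈ T := by
      intro K' hK' e he
      rcases mem_union.1 he with he | he
      · rcases mem_union.1 (hK' he) with he | he
        · exact mem_union_left _ he
        · rw [mem_filter] at he
          exact mem_union_right _ (mem_filter.2 ⟨mem_univ _, he.2, S, List.mem_cons_self, he.1⟩)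
      · rw [mem_filter] at he
        obtain ⟨-, he1, T, hT, heT⟩ := he
        exact mem_union_right _ (mem_filter.2 ⟨mem_univ _, he1, T, List.mem_cons_of_mem _ hT, heT⟩)
    rw [swRun_cons]
    split_ifs
    · exact (ih K).trans (hstep K subset_union_left)
    · exact (ih K).trans (hstep K subset_union_left)
    · exact (subset_union_left (s₂ := (univ.filter fun e : (⊤ : SimpleGraph (Fin n)).edgeSet =>
          (∀ v ∈ (e : Sym2 (Fin n)), v ∈ V) ∧ ∃ T ∈ l, e ∈ T))).trans (hstep _ subset_rfl)
    · exact (ih _).trans (hstep _ subset_rfl)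

open Classical in
/-- Every queried slot of the run from `∅` is inside `V`. [folklore] -/
theorem inside_of_mem_swRun_snd (V : Finset (Fin n)) (x z : EdgeVec n)
    (l : List (Finset (⊤ : SimpleGraph (Fin n)).edgeSet)) {e : (⊤ : SimpleGraph (Fin n)).edgeSet}
    (he : e ∈ (swRun V x z l ∅).2) : ∀ v ∈ (e : Sym2 (Fin n)), v ∈ V := by
  have h := swRun_snd_subset V x z l ∅ he
  rw [empty_union, mem_filter] at h
  exact h.2.1

/-! ### Determinacy -/

open Classical in
/-- **Determinacy of the canonical run**: two inside assignments agreeing on the final queried set of the first have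
the same run (same value, same queried set). [cite: Beame1994, §3] -/
theorem swRun_congr_inside (V : Finset (Fin n)) (x : EdgeVec n) {z z' : EdgeVec n}
    (l : List (Finset (⊤ : SimpleGraph (Fin n)).edgeSet)) (K : Finset (⊤ : SimpleGraph (Fin n)).edgeSet)
    (h : ∀ e ∈ (swRun V x z l K).2, z e = z' e) : swRun V x z' l K = swRun V x z l K := by
  induction l generalizing K with
  | nil => simp
  | cons S l ih =>
    have hK : ∀ e ∈ K, z e = z' e := fun e he => h e (subset_swRun_snd V x z (S :: l) K he)
    rw [swRun_cons, swRun_cons]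
    by_cases h1 : ∃ e ∈ S, (¬ ∀ v ∈ (e : Sym2 (Fin n)), v ∈ V) ∧ x e = true
    · rw [if_pos h1, if_pos h1]
      rw [swRun_cons, if_pos h1] at h
      exact ih K h
    rw [if_neg h1, if_neg h1]
    have h2iff : (∃ e ∈ S, (∀ v ∈ (e : Sym2 (Fin n)), v ∈ V) ∧ e ∈ K ∧ z' e = true) ↔
        ∃ e ∈ S, (∀ v ∈ (e : Sym2 (Fin n)), v ∈ V) ∧ e ∈ K ∧ z e = true := by
      refine exists_congr fun e => and_congr_right fun _ => and_congr_right fun _ => and_congr_right fun heK => ?_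
      rw [hK e heK]
    by_cases h2 : ∃ e ∈ S, (∀ v ∈ (e : Sym2 (Fin n)), v ∈ V) ∧ e ∈ K ∧ z e = true
    · rw [if_pos (h2iff.2 h2), if_pos h2]
      rw [swRun_cons, if_neg h1, if_pos h2] at h
      exact ih K h
    rw [if_neg (fun h' => h2 (h2iff.1 h')), if_neg h2]
    -- the inside slots of `S` are queried now, hence in the final set
    set K' := K ∪ S.filter (fun e => ∀ v ∈ (e : Sym2 (Fin n)), v ∈ V) with hK'
    have hK'fin : K' ⊆ (swRun V x z (S :: l) K).2 := by
      rw [swRun_cons, if_neg h1, if_neg h2]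
      split_ifs
      · exact subset_rfl
      · exact subset_swRun_snd V x z l K'
    have hS : ∀ e ∈ S, (∀ v ∈ (e : Sym2 (Fin n)), v ∈ V) → z e = z' e := fun e he he1 =>
      h e (hK'fin (mem_union_right _ (mem_filter.2 ⟨he, he1⟩)))
    have h3iff : (∀ e ∈ S, (∀ v ∈ (e : Sym2 (Fin n)), v ∈ V) → z' e = false) ↔
        ∀ e ∈ S, (∀ v ∈ (e : Sym2 (Fin n)), v ∈ V) → z e = false := by
      refine forall₂_congr fun e he => forall_congr' fun he1 => ?_
      rw [hS e he he1]
    by_cases h3 : ∀ e ∈ S, (∀ v ∈ (e : Sym2 (Fin n)), v ∈ V) → z e = false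
    · rw [if_pos (h3iff.2 h3), if_pos h3]
    · rw [if_neg (fun h' => h3 (h3iff.1 h')), if_neg h3]
      rw [swRun_cons, if_neg h1, if_neg h2, if_neg h3] at h
      exact ih K' h

open Classical in
/-- The run depends on the outside assignment only through the slots NOT inside `V`. [folklore] -/
theorem swRun_congr_outside (V : Finset (Fin n)) {x x' : EdgeVec n} (z : EdgeVec n)
    (h : ∀ e : (⊤ : SimpleGraph (Fin n)).edgeSet, (¬ ∀ v ∈ (e : Sym2 (Fin n)), v ∈ V) → x e = x' e)
    (l : List (Finset (⊤ : SimpleGraph (Fin n)).edgeSet)) (K : Finset (⊤ : SimpleGraph (Fin n)).edgeSet) :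
    swRun V x' z l K = swRun V x z l K := by
  induction l generalizing K with
  | nil => simp
  | cons S l ih =>
    have h1iff : (∃ e ∈ S, (¬ ∀ v ∈ (e : Sym2 (Fin n)), v ∈ V) ∧ x' e = true) ↔
        ∃ e ∈ S, (¬ ∀ v ∈ (e : Sym2 (Fin n)), v ∈ V) ∧ x e = true := by
      refine exists_congr fun e => and_congr_right fun _ => ?_
      refine ⟨fun ⟨he1, he2⟩ => ⟨he1, by rw [h e he1]; exact he2⟩, fun ⟨he1, he2⟩ => ⟨he1, by rw [← h e he1]; exact he2⟩⟩
    rw [swRun_cons, swRun_cons]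
    simp only [h1iff, ih]

/-! ### DNF extraction -/

open Classical in
/-- **DNF extraction from the canonical run.** The restricted CNF accepts the inside assignment `z'` iff some accepted
`z` has all its black queried slots black in `z'` (determinacy + monotonicity: the assignment that is black exactly on
the black queried slots of `z` has the same run as `z`, and `z'` dominates it). [cite: Beame1994, §3] -/
theorem swRun_dnf (V : Finset (Fin n)) (x : EdgeVec n) (l : List (Finset (⊤ : SimpleGraph (Fin n)).edgeSet))
    (z' : EdgeVec n) :
    (swRun V x z' l ∅).1 = true ↔
      ∃ z : EdgeVec n, (swRun V x z l ∅).1 = true ∧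
        ∀ e ∈ (swRun V x z l ∅).2, z e = true → z' e = true := by
  refine ⟨fun h => ⟨z', h, fun _ _ he => he⟩, ?_⟩
  rintro ⟨z, hz, hdom⟩
  -- the minimal assignment with the same run
  set zs : EdgeVec n := fun e => decide (e ∈ (swRun V x z l ∅).2 ∧ z e = true) with hzs
  have hagree : ∀ e ∈ (swRun V x z l ∅).2, z e = zs e := by
    intro e he
    rw [hzs]
    cases hze : z e <;> simp [he, hze]
  have hrun : swRun V x zs l ∅ = swRun V x z l ∅ := swRun_congr_inside V x l ∅ hagree
  have hzs1 : (swRun V x zs l ∅).1 = true := by rw [hrun]; exact hz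
  rw [swRun_fst_eq_true_iff] at hzs1 ⊢
  intro S hS
  obtain ⟨e, he, h⟩ := hzs1 S hS
  rcases h with ⟨he1, he2⟩ | ⟨he1, he2⟩
  · refine ⟨e, he, Or.inl ⟨he1, ?_⟩⟩
    rw [hzs, decide_eq_true_eq] at he2
    exact hdom e he2.1 he2.2
  · exact ⟨e, he, Or.inr ⟨he1, he2⟩⟩

/-- `Σ_{j ≤ r} C(N, j) ≤ (N+1)^r`. [folklore] -/
theorem switch_sum_range_choose_le_pow (N r : ℕ) : ∑ j ∈ range (r + 1), N.choose j ≤ (N + 1) ^ r := by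
  induction r with
  | zero => simp
  | succ r ih =>
    rw [sum_range_succ, pow_succ]
    have h1 : N.choose (r + 1) ≤ N * (N + 1) ^ r := by
      calc N.choose (r + 1) ≤ N ^ (r + 1) := Nat.choose_le_pow _ _
        _ = N * N ^ r := by ring
        _ ≤ N * (N + 1) ^ r := Nat.mul_le_mul_left _ (Nat.pow_le_pow_left (Nat.le_succ N) r)
    calc ∑ j ∈ range (r + 1), N.choose j + N.choose (r + 1) ≤ (N + 1) ^ r + N * (N + 1) ^ r := add_le_add ih h1
      _ = (N + 1) ^ r * (N + 1) := by ring

/-- The subsets of size `≤ r` of a finite type with `N` elements number at most `(N+1)^r`. [folklore] -/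
theorem switch_card_filter_powerset_card_le {ι : Type*} [Fintype ι] [DecidableEq ι] (r : ℕ) :
    #((univ : Finset ι).powerset.filter fun T => #T ≤ r) ≤ (Fintype.card ι + 1) ^ r := by
  have h : ((univ : Finset ι).powerset.filter fun T => #T ≤ r) =
      (range (r + 1)).biUnion fun j => powersetCard j (univ : Finset ι) := by
    ext T
    simp only [mem_filter, mem_powerset, subset_univ, true_and, mem_biUnion, mem_range, mem_powersetCard,
      Nat.lt_succ_iff]
    exact ⟨fun hT => ⟨#T, hT, rfl⟩, fun ⟨j, hj, hTj⟩ => hTj ▸ hj⟩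
  rw [h]
  refine (card_biUnion_le).trans ?_
  refine le_trans (sum_le_sum fun j _ => ?_) (switch_sum_range_choose_le_pow (Fintype.card ι) r)
  rw [card_powersetCard, card_univ]

open Classical in
/-- **The restricted CNF is an `r`-DNF when every run queries at most `r` slots.** The terms are inside `V`, have
`≤ r` slots, and there are at most `(#slots + 1)^r` of them. [cite: Beame1994, §3] -/
theorem swRun_exists_dnf (V : Finset (Fin n)) (x : EdgeVec n) (l : List (Finset (⊤ : SimpleGraph (Fin n)).edgeSet))
    (r : ℕ) (hr : ∀ z : EdgeVec n, #(swRun V x z l ∅).2 ≤ r) :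
    ∃ 𝓣 : Finset (Finset (⊤ : SimpleGraph (Fin n)).edgeSet),
      #𝓣 ≤ (Fintype.card (⊤ : SimpleGraph (Fin n)).edgeSet + 1) ^ r ∧
      (∀ T ∈ 𝓣, #T ≤ r ∧ ∀ e ∈ T, ∀ v ∈ (e : Sym2 (Fin n)), v ∈ V) ∧
      ∀ z' : EdgeVec n, ((swRun V x z' l ∅).1 = true ↔ ∃ T ∈ 𝓣, ∀ e ∈ T, z' e = true) := by
  refine ⟨(univ.filter fun z : EdgeVec n => (swRun V x z l ∅).1 = true).image
      fun z => (swRun V x z l ∅).2.filter fun e => z e = true, ?_, ?_, ?_⟩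
  · refine le_trans (card_le_card ?_) (switch_card_filter_powerset_card_le r)
    intro T hT
    rw [mem_image] at hT
    obtain ⟨z, -, rfl⟩ := hT
    rw [mem_filter, mem_powerset]
    exact ⟨subset_univ _, (card_filter_le _ _).trans (hr z)⟩
  · intro T hT
    rw [mem_image] at hT
    obtain ⟨z, -, rfl⟩ := hT
    refine ⟨(card_filter_le _ _).trans (hr z), fun e he => ?_⟩
    rw [mem_filter] at he
    exact inside_of_mem_swRun_snd V x z l he.1
  · intro z'
    rw [swRun_dnf]
    constructor
    · rintro ⟨z, hz, hdom⟩
      refine ⟨(swRun V x z l ∅).2.filter fun e => z e = true, mem_image.2 ⟨z, mem_filter.2 ⟨mem_univ _, hz⟩, rfl⟩,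
        fun e he => ?_⟩
      rw [mem_filter] at he
      exact hdom e he.1 he.2
    · rintro ⟨T, hT, hTz'⟩
      rw [mem_image] at hT
      obtain ⟨z, hz, rfl⟩ := hT
      rw [mem_filter] at hz
      exact ⟨z, hz.2, fun e he hze => hTz' e (mem_filter.2 ⟨he, hze⟩)⟩

end Summit.PneNP.PneNP.Theorems

/-- Registered stub `stub_switchRun` of the clique-restriction switching line (this file's countable content: the
number of possible terms of the extracted `r`-DNF is controlled by `Σ_{j ≤ r} C(N, j) ≤ (N+1)^r`). [folklore] -/
theorem Summit.PneNP.PneNP.Theorems.stub_switchRun :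
    ∀ N r : ℕ, ∑ j ∈ Finset.range (r + 1), N.choose j ≤ (N + 1) ^ r :=
  fun N r => Summit.PneNP.PneNP.Theorems.switch_sum_range_choose_le_pow N r
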